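import Literature.Probability.NegativeDependence.DeterminantalMeasures
import Literature.Probability.NegativeDependence.TruncationStochasticDomination
import Literature.Combinatorics.StablePolynomials.AffineDeterminantalPencil
import Literature.Combinatorics.StablePolynomials.ProperPositionSpecialization
import Literature.LinearAlgebra.Matrix.ContractionLoewnerMonotone
import Mathlib.LinearAlgebra.Matrix.Polynomial
import Mathlib.Analysis.Matrix.Order
import Mathlib.Analysis.SpecificLimits.Basic
import HarnessLib

/-!
# Stochastic domination of determinantal measures from the Loewner order
# (Borcea–Brändén–Liggett, Proposition 4.15 and Theorem 4.13 — the extension of Lyons' theorem)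

J. Borcea, P. Brändén, T. M. Liggett, *Negative dependence and the geometry of polynomials*, J. Amer. Math.
Soc. 22 (2009) 521–567 (arXiv:0707.2340, held `paper:arxiv-0707.2340`; numbering of the arXiv version), §4.3.1.
Verbatim (p. 17–18):

> **Theorem 4.13.** Let `A` and `B` be positive contractions such that `A ≤ B` and let `μ` and `ν` be their
> corresponding determinantal measures. Then `μ ⊴ ν` and thus `μ ≼ ν`.
> In [Lyons] Lyons proved the last statement (`μ ≼ ν`) in Theorem 4.13 under the additional hypothesis
> `[A, B] = 0`. […]
> **Proposition 4.15.** Let `A` and `B` be positive semi-definite `n × n` matrices such that `A ≤ B` and set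
> `Z = diag(z_1, …, z_n)`. Then `det(I + AZ)/det(I + A) ⊴ det(I + BZ)/det(I + B)` and
> `det(B + Z)/det(B + I) ⊴ det(A + Z)/det(A + I)`. Moreover, if `A` and `B` are positive contractions, then
> `det(I - A + AZ) ⊴ det(I - B + BZ)`.
> *Proof.* We just prove the first inequality. […] for the third inequality note that if `A ≤ B` and `A, B` are
> positive contractions then by continuity we may assume that `B < I`. But then `A' = A(I-A)⁻¹ ≤ B(I-B)⁻¹ = B'`
> by Lemma 4.14, hence `det(I - A + AZ) = det(I + A'Z)/det(I + A') ⊴ det(I + B'Z)/det(I + B') = det(I - B + BZ)`.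
> We claim that the polynomial `f ∈ ℝ[z_1, …, z_n, y]` defined by
> `f(z, y) = det(y(I + AZ) + I + BZ) := y^n P_0(z) + y^{n-1} P_1(z) + ⋯ + P_n(z)` is real stable with
> non-negative coefficients. Assuming this claim we see that since `P_k(z) = (n-k)!⁻¹ ∂^{n-k}f/∂y^{n-k}|_{y=0}`,
> by Remark 4.1 we have that `det(I + AZ) = P_0 ≪ P_1 ≪ ⋯ ≪ P_n = det(I + BZ)`, which then settles the lemma
> (note that `P_k(0) = C(n,k)`, so none of the `P_k`'s is identically zero). To prove the remaining claim, note
> that the polynomial `G(z, y) = det(A + y(B - A) + Z)` is stable with non-negative coefficients by Proposition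
> 3.2. Hence, so are the polynomials `F(z, y) = z_1 ⋯ z_n y^n G(z_1⁻¹, …, z_n⁻¹, y⁻¹) = det(y(I + AZ) + (B - A)Z)`
> and `F(z, y+1) = det(y(I + AZ) + I + BZ) = f(z, y)`. □
> *Proof of Theorem 4.13.* The generating polynomials of `μ` and `ν` are `det(I - A + AZ)` and `det(I - B + BZ)`,
> respectively. Combine Propositions 4.12 and 4.15. □

## What is formalized (real symmetric matrices `A, B : Matrix σ σ ℝ`; weights `Finset σ → ℝ`)

The orders `⊴′`, `⊴` and `≼` are the tree's `SRLe'`, `SRLe` (Def. 4.1) and `StochDom`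
(`ProperPositionStochasticDomination.lean`, with Prop. 4.12 `SRLe.stochDom`); determinantal weights are the tree's
`IsDeterminantal μ K` (`DeterminantalMeasures.lean`, with `g_μ(z) = det(I - K + diag(z) K)`).

* §1 `det_smul_one_add_diagonal_mul`: `det(cI + diag(y)A) = Σ_S c^{n-|S|} y^S det A[S]`.
* §2 `minorWeight M S = det M[S]` (generating polynomial `det(I + diag(z) M)`, `sum_minorWeight_mul_prod`; mass
  `det(I + M) ≥ 1` for `M ⪰ 0`), the minor pencil `minorPencil A B S = (1+y)^{n-|S|} det(y A[S] + B[S]) ∈ ℝ[y]`, the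
  layer weights `layerWeight A B j S = [y^j] minorPencil A B S` and BBL's polynomial
  `layerPoly A B = Σ_j y^j Σ_S w_j(S) z^S ∈ ℝ[z_σ, y]` (`y` = the variable `none`); `layerWeight_card = minorWeight A`
  (`P_0 = det(I + AZ)`), `layerWeight_zero = minorWeight B` (`P_n = det(I + BZ)`), `layerWeight_empty = C(n, j)`.
* §3 `eval_layerPoly`: `f(z, y) = det((y+1)I + diag(z)(yA + B))` (BBL's `det(y(I + AZ) + I + BZ)` up to
  transposition, immaterial for symmetric `A, B`); **`isRealStable_layerPoly`** (`0 ≤ A ≤ B`): the printed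
  inversion–shift route `f(z,y) = F(z, y+1)`, `F = z_1⋯z_n y^n G(1/z, 1/y)`, made pointwise — the matrix factorization
  `layerMatrix_eq` reduces `f(z,y) ≠ 0` on `ℋ^{n+1}` to the kernel of the affine pencil `diag(w) + s(B-A) + A` at a
  point of `(-ℋ)^{n+1}`, which the tree's Prop. 3.2 kernel lemma (`pencil_mulVec_eq_zero_imp`,
  `AffineDeterminantalPencil.lean`) shows trivial.
* §4 **`coeff_det_X_smul_add_nonneg`**: `det(y A' + B') ∈ ℝ[y]` has non-negative coefficients for `A', B' ⪰ 0` (its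
  zeros are real `≤ 0` by the quadratic-form argument of Prop. 3.2, and its coefficients then have one phase by the
  tree's `exists_unit_mul_coeff_nonneg_of_roots_nonpos`; this replaces BBL's appeal to Prop. 3.2 (2)).
* §5 `coeff_optionEquivLeft_layerPoly` (the `y^j`-coefficient of `f` is `Σ_S w_j(S) z^S`), `layerWeight_nonneg`,
  `multiAffine_layerWeight_ne_zero` (`P_k(0) = C(n,k)`), **`isProperPosition_layerWeight`** (consecutive layers in
  proper position: the tree's Remark 4.1 chain lemma `IsRealStable.coeff_optionEquivLeft_properPosition`,
  `ProperPositionSpecialization.lean`), the normalized laws `layerLaw`, `minorLaw M S = det M[S]/det(I + M)`,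
  `srStep_layerLaw`, `SRLe'.trans`, `srLe'_layerLaw`.
* §6 **`BorceaBrandenLiggett_prop_4_15`**: `minorLaw A ⊴′ minorLaw B` for `0 ≤ A ≤ B` (first display; hence `⊴`,
  `≼`, `E F` comparisons: `_srLe`, `stochDom_minorLaw`, `ex_minorLaw_le`).
* §7 `IsDeterminantal.mass_eq_one`, `det_one_sub_add_diagonal_mul_eq`
  (`det(I - A + diag(z)A) = det(I + diag(z)A') det(I - A)`), `IsDeterminantal.eq_minorLaw` (`μ_A = minorLaw A'`),
  `posSemidef_mul_inv_one_sub` (`A' ⪰ 0`), **`BorceaBrandenLiggett_thm_4_13`**: `μ ⊴′ ν` for determinantal `μ, ν`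
  with kernels `0 ≤ A ≤ B < I` (third display of Prop. 4.15 with the tree's Lemma 4.14,
  `ContractionLoewnerMonotone.lean`), `_stochDom`.
* §8 `detWeight K` (inclusion–exclusion), `sum_detWeight_mul_prod`, `isDeterminantal_detWeight`,
  `IsDeterminantal.eq_detWeight` (uniqueness), `continuous_detWeight_smul`, and
  **`BorceaBrandenLiggett_thm_4_13_srLe`**: `μ ⊴ ν` for all positive contractions `0 ≤ A ≤ B ≤ I` ("by
  continuity": `(tA, tB)`, `t = k/(k+1) ↑ 1`), `BorceaBrandenLiggett_thm_4_13_stochDom'` (`μ ≼ ν`).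

Not here: the second display of Prop. 4.15 (`det(B + Z)/det(B + I) ⊴ det(A + Z)/det(A + I)`, by inversion);
complex Hermitian kernels (the tree's `IsDeterminantal` allows them; the measures here have real symmetric kernels).

## References

* [BorceaBrandenLiggett2007] J. Borcea, P. Brändén, T. M. Liggett, Negative dependence and the geometry of
  polynomials, J. Amer. Math. Soc. 22 (2009), 521–567; arXiv:0707.2340 — §4.3.1 Thm. 4.13, Lemma 4.14, Prop. 4.15.
* [Lyons2003] R. Lyons, Determinantal probability measures, Publ. Math. IHÉS 98 (2003), 167–212 — Thm. 6.2 / the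
  case `[A, B] = 0`.
-/

noncomputable section

open MvPolynomial Finset Matrix Filter
open Literature.Combinatorics.StablePolynomials
open Literature.Combinatorics.Sahi2008 (ex)
open Literature.Probability.MarkovChains (StochDom)
open scoped ComplexOrder Topology

namespace Literature.Probability.NegativeDependence

variable {σ : Type*} [Fintype σ] [DecidableEq σ]

/-! ## §1 Principal-minor expansion of `det(c I + diag(y) A)` -/

section Expansion

variable {R : Type*} [CommRing R]

/-- **Principal-minor expansion**: `det(c I + diag(y) A) = Σ_S c^{n-|S|} y^S det A[S]`.
[cite: BorceaBrandenLiggett2007, §4.3.1 proof of Prop. 4.15 (the polynomial `det(y(I + AZ) + I + BZ)`)] -/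
theorem det_smul_one_add_diagonal_mul (c : R) (y : σ → R) (A : Matrix σ σ R) :
    (c • (1 : Matrix σ σ R) + diagonal y * A).det = ∑ S : Finset σ, c ^ (Fintype.card σ - S.card) *
      (∏ i ∈ S, y i) * (A.submatrix (Subtype.val : S → σ) (Subtype.val : S → σ)).det := by
  have hrows : (c • (1 : Matrix σ σ R) + diagonal y * A : Matrix σ σ R) =
      (fun i => (diagonal y * A) i) + fun i => (c • (1 : Matrix σ σ R)) i := by
    ext i j
    simp [add_comm]
  rw [det, hrows, AlternatingMap.map_add_univ]
  refine Finset.sum_congr rfl fun S _ => ?_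
  have hpw : (S.piecewise (fun i => (diagonal y * A) i) fun i => (c • (1 : Matrix σ σ R)) i) =
      of fun i j => (if i ∈ S then y i else c) * (of (S.piecewise A.row (1 : Matrix σ σ R).row)) i j := by
    ext i j
    by_cases hi : i ∈ S
    · simp [Finset.piecewise, hi, diagonal_mul, Matrix.row]
    · simp [Finset.piecewise, hi, Matrix.row, Matrix.one_apply]
  rw [hpw]
  change det _ = _
  rw [det_mul_column, det_piecewise_one_eq_submatrix_det, Finset.prod_ite, Finset.prod_const,
    Finset.filter_mem_eq_inter, Finset.univ_inter]
  have hc : (univ.filter fun i => i ∉ S).card = Fintype.card σ - S.card := by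
    rw [Finset.filter_not, Finset.filter_mem_eq_inter, Finset.univ_inter, Finset.card_sdiff, Finset.inter_univ,
      Finset.card_univ]
  rw [hc]
  ring

end Expansion

/-! ## §2 Principal-minor weights and the two-parameter polynomial of Prop. 4.15 -/

section Weights

/-- The principal-minor weight `S ↦ det M[S]` of a real square matrix: the (unnormalized) measure with generating
polynomial `det(I + MZ)` ("`det(I + AZ)/det(I + A)`" of Prop. 4.15 after normalization).
[cite: BorceaBrandenLiggett2007, §4.3.1 Prop. 4.15] -/
def minorWeight (M : Matrix σ σ ℝ) : Finset σ → ℝ := fun S =>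
  (M.submatrix (Subtype.val : S → σ) (Subtype.val : S → σ)).det

omit [Fintype σ] in
/-- Unfolding `minorWeight`. [cite: BorceaBrandenLiggett2007, §4.3.1 Prop. 4.15] -/
theorem minorWeight_apply (M : Matrix σ σ ℝ) (S : Finset σ) :
    minorWeight M S = (M.submatrix (Subtype.val : S → σ) (Subtype.val : S → σ)).det := rfl

omit [Fintype σ] in
/-- `det M[∅] = 1`. [cite: BorceaBrandenLiggett2007, §4.3.1 Prop. 4.15] -/
theorem minorWeight_empty (M : Matrix σ σ ℝ) : minorWeight M ∅ = 1 := by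
  rw [minorWeight_apply]
  haveI : IsEmpty ((∅ : Finset σ) : Type _) := ⟨fun x => (Finset.notMem_empty _ x.2).elim⟩
  exact Matrix.det_isEmpty

omit [Fintype σ] in
/-- Principal minors of a positive semidefinite matrix are non-negative. [cite: BorceaBrandenLiggett2007, §3.3
("positive contraction") / §4.3.1 Prop. 4.15] -/
theorem minorWeight_nonneg {M : Matrix σ σ ℝ} (hM : M.PosSemidef) (S : Finset σ) : 0 ≤ minorWeight M S :=
  (hM.submatrix _).det_nonneg

/-- The mass `Σ_S det M[S] = det(I + M)` is positive for positive semidefinite `M` (it is `≥ det M[∅] = 1`).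
[cite: BorceaBrandenLiggett2007, §4.3.1 Prop. 4.15] -/
theorem mass_minorWeight_pos {M : Matrix σ σ ℝ} (hM : M.PosSemidef) : 0 < mass (minorWeight M) := by
  rw [mass]
  calc (0 : ℝ) < 1 := one_pos
    _ = minorWeight M ∅ := (minorWeight_empty M).symm
    _ ≤ ∑ S, minorWeight M S :=
        Finset.single_le_sum (fun S _ => minorWeight_nonneg hM S) (Finset.mem_univ _)

/-- The generating polynomial of the principal-minor weight: `Σ_S det M[S] z^S = det(I + diag(z) M)`.
[cite: BorceaBrandenLiggett2007, §4.3.1 Prop. 4.15 ("`det(I + AZ)`")] -/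
theorem sum_minorWeight_mul_prod (M : Matrix σ σ ℝ) (z : σ → ℂ) :
    ∑ S : Finset σ, (minorWeight M S : ℂ) * ∏ i ∈ S, z i =
      (1 + diagonal z * M.map (algebraMap ℝ ℂ)).det := by
  rw [det_one_add_diagonal_mul]
  refine Finset.sum_congr rfl fun S _ => ?_
  rw [mul_comm, minorWeight_apply]
  congr 1
  have := RingHom.map_det (algebraMap ℝ ℂ) (M.submatrix (Subtype.val : S → σ) (Subtype.val : S → σ))
  rw [RingHom.mapMatrix_apply] at this
  exact this

variable (A B : Matrix σ σ ℝ)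

/-- The principal-minor pencil `q_S(y) = (1 + y)^{n-|S|} · det(y A[S] + B[S]) ∈ ℝ[y]` — the coefficient of `z^S` in
BBL's `f(z, y) = det(y(I + AZ) + I + BZ) = det((y+1) I + (yA + B) Z)`. [cite: BorceaBrandenLiggett2007, §4.3.1
proof of Prop. 4.15] -/
def minorPencil (S : Finset σ) : Polynomial ℝ :=
  (1 + Polynomial.X) ^ (Fintype.card σ - S.card) *
    ((Polynomial.X : Polynomial ℝ) • (A.submatrix (Subtype.val : S → σ) (Subtype.val : S → σ)).map Polynomial.C +
      (B.submatrix (Subtype.val : S → σ) (Subtype.val : S → σ)).map Polynomial.C).det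

/-- The `j`-th layer weight `w_j(S) = [y^j] q_S(y)`: BBL's `P_{n-j} = Σ_S w_j(S) z^S` is the coefficient of `y^j` in
`f(z, y) = y^n P_0(z) + y^{n-1} P_1(z) + ⋯ + P_n(z)`. [cite: BorceaBrandenLiggett2007, §4.3.1 proof of Prop. 4.15] -/
def layerWeight (j : ℕ) : Finset σ → ℝ := fun S => (minorPencil A B S).coeff j

/-- BBL's two-parameter polynomial `f(z, y) = Σ_j y^j P_{n-j}(z) = det((y+1) I + (yA + B) Z)` (variable `y` =
`none`, `z_i` = `some i`). [cite: BorceaBrandenLiggett2007, §4.3.1 proof of Prop. 4.15] -/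
def layerPoly : MvPolynomial (Option σ) ℝ :=
  ∑ j ∈ range (Fintype.card σ + 1), X none ^ j * rename some (multiAffine (layerWeight A B j))

/-- `deg q_S ≤ n`. [cite: BorceaBrandenLiggett2007, §4.3.1 proof of Prop. 4.15] -/
theorem natDegree_minorPencil_le (S : Finset σ) : (minorPencil A B S).natDegree ≤ Fintype.card σ := by
  rw [minorPencil]
  refine (Polynomial.natDegree_mul_le).trans ?_
  have h1 : ((1 + Polynomial.X : Polynomial ℝ) ^ (Fintype.card σ - S.card)).natDegree ≤ Fintype.card σ - S.card := by
    refine (Polynomial.natDegree_pow_le).trans ?_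
    have : (1 + Polynomial.X : Polynomial ℝ).natDegree ≤ 1 := by compute_degree
    calc (Fintype.card σ - S.card) * (1 + Polynomial.X : Polynomial ℝ).natDegree
        ≤ (Fintype.card σ - S.card) * 1 := Nat.mul_le_mul_left _ this
      _ = Fintype.card σ - S.card := mul_one _
  have h2 := Polynomial.natDegree_det_X_add_C_le (A.submatrix (Subtype.val : S → σ) (Subtype.val : S → σ))
    (B.submatrix (Subtype.val : S → σ) (Subtype.val : S → σ))
  rw [Fintype.card_coe] at h2
  have hS : S.card ≤ Fintype.card σ := by
    simpa using Finset.card_le_univ S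
  omega

/-- `w_j = 0` for `j > n`. [cite: BorceaBrandenLiggett2007, §4.3.1 proof of Prop. 4.15] -/
theorem layerWeight_eq_zero_of_lt {j : ℕ} (hj : Fintype.card σ < j) : layerWeight A B j = 0 := by
  funext S
  exact Polynomial.coeff_eq_zero_of_natDegree_lt ((natDegree_minorPencil_le A B S).trans_lt hj)

/-- `w_j(∅) = C(n, j)`. [cite: BorceaBrandenLiggett2007, §4.3.1 proof of Prop. 4.15] -/
theorem layerWeight_empty (j : ℕ) : layerWeight A B j ∅ = ((Fintype.card σ).choose j : ℝ) := by
  rw [layerWeight, minorPencil, Finset.card_empty, Nat.sub_zero]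
  haveI : IsEmpty ((∅ : Finset σ) : Type _) := ⟨fun x => (Finset.notMem_empty _ x.2).elim⟩
  rw [Matrix.det_isEmpty, mul_one, Polynomial.coeff_one_add_X_pow]

/-- Top layer: `w_n(S) = det A[S]`. [cite: BorceaBrandenLiggett2007, §4.3.1 proof of Prop. 4.15
("`det(I + AZ) = P_0`")] -/
theorem layerWeight_card : layerWeight A B (Fintype.card σ) = minorWeight A := by
  funext S
  rw [layerWeight, minorWeight_apply, minorPencil]
  set m := Fintype.card σ - S.card with hm
  set p := ((Polynomial.X : Polynomial ℝ) • (A.submatrix (Subtype.val : S → σ) (Subtype.val : S → σ)).map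
    Polynomial.C + (B.submatrix (Subtype.val : S → σ) (Subtype.val : S → σ)).map Polynomial.C).det with hp
  have hS : S.card ≤ Fintype.card σ := by simpa using Finset.card_le_univ S
  have hn : Fintype.card σ = m + S.card := by omega
  have hdeg : p.natDegree ≤ S.card := by
    have := Polynomial.natDegree_det_X_add_C_le (A.submatrix (Subtype.val : S → σ) (Subtype.val : S → σ))
      (B.submatrix (Subtype.val : S → σ) (Subtype.val : S → σ))
    rwa [Fintype.card_coe] at this
  rw [hn, Polynomial.coeff_mul_add_eq_of_natDegree_le (Polynomial.natDegree_pow_le.trans (by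
      calc m * (1 + Polynomial.X : Polynomial ℝ).natDegree ≤ m * 1 :=
            Nat.mul_le_mul_left _ (by compute_degree)
        _ = m := mul_one _)) hdeg]
  have h1 : ((1 + Polynomial.X : Polynomial ℝ) ^ m).coeff m = 1 := by
    rw [Polynomial.coeff_one_add_X_pow, Nat.choose_self, Nat.cast_one]
  have h2 : p.coeff S.card = (A.submatrix (Subtype.val : S → σ) (Subtype.val : S → σ)).det := by
    have := Polynomial.coeff_det_X_add_C_card (A.submatrix (Subtype.val : S → σ) (Subtype.val : S → σ))
      (B.submatrix (Subtype.val : S → σ) (Subtype.val : S → σ))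
    rwa [Fintype.card_coe] at this
  rw [h1, h2, one_mul]

/-- Bottom layer: `w_0(S) = det B[S]`. [cite: BorceaBrandenLiggett2007, §4.3.1 proof of Prop. 4.15
("`P_n = det(I + BZ)`")] -/
theorem layerWeight_zero : layerWeight A B 0 = minorWeight B := by
  funext S
  rw [layerWeight, minorWeight_apply, minorPencil, Polynomial.mul_coeff_zero, Polynomial.coeff_zero_eq_eval_zero]
  simp only [Polynomial.eval_pow, Polynomial.eval_add, Polynomial.eval_one, Polynomial.eval_X, add_zero, one_pow,
    one_mul]
  have := Polynomial.coeff_det_X_add_C_zero (A.submatrix (Subtype.val : S → σ) (Subtype.val : S → σ))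
    (B.submatrix (Subtype.val : S → σ) (Subtype.val : S → σ))
  exact this

end Weights

/-! ## §3 `f(z, y) = det((y+1) I + diag(z)(yA + B))` and its real stability -/

section Stability

variable (A B : Matrix σ σ ℝ)

/-- Evaluating the minor pencil: `q_S(y) = (1 + y)^{n-|S|} det(y A[S] + B[S])` over `ℂ`.
[cite: BorceaBrandenLiggett2007, §4.3.1 proof of Prop. 4.15] -/
theorem aeval_minorPencil (S : Finset σ) (y : ℂ) :
    Polynomial.aeval y (minorPencil A B S) = (1 + y) ^ (Fintype.card σ - S.card) *
      (y • (A.map (algebraMap ℝ ℂ)).submatrix (Subtype.val : S → σ) (Subtype.val : S → σ) +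
        (B.map (algebraMap ℝ ℂ)).submatrix (Subtype.val : S → σ) (Subtype.val : S → σ)).det := by
  rw [minorPencil, map_mul, map_pow, map_add, map_one, Polynomial.aeval_X, AlgHom.map_det]
  congr 2
  ext p q
  simp only [AlgHom.mapMatrix_apply, Matrix.map_apply, Matrix.add_apply, Matrix.smul_apply, Matrix.submatrix_apply,
    smul_eq_mul, map_add, map_mul, Polynomial.aeval_X, Polynomial.aeval_C, Complex.coe_algebraMap, mul_comm y]

/-- `Σ_{j ≤ n} w_j(S) y^j = q_S(y)`. [cite: BorceaBrandenLiggett2007, §4.3.1 proof of Prop. 4.15] -/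
theorem sum_layerWeight_mul_pow (S : Finset σ) (y : ℂ) :
    ∑ j ∈ range (Fintype.card σ + 1), (layerWeight A B j S : ℂ) * y ^ j =
      Polynomial.aeval y (minorPencil A B S) := by
  rw [Polynomial.aeval_eq_sum_range' (Nat.lt_succ_of_le (natDegree_minorPencil_le A B S))]
  refine Finset.sum_congr rfl fun j _ => ?_
  rw [layerWeight, Complex.real_smul]

/-- **`f(z, y) = det((y + 1) I + diag(z) (yA + B))`** (`= det(y(I + AZ) + I + BZ)` of BBL for symmetric `A, B`, up
to transposing). [cite: BorceaBrandenLiggett2007, §4.3.1 proof of Prop. 4.15] -/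
theorem eval_layerPoly (z : σ → ℂ) (y : ℂ) :
    eval (fun o => Option.elim o y z) (MvPolynomial.map (algebraMap ℝ ℂ) (layerPoly A B)) =
      ((y + 1) • (1 : Matrix σ σ ℂ) +
        diagonal z * (y • A.map (algebraMap ℝ ℂ) + B.map (algebraMap ℝ ℂ))).det := by
  rw [det_smul_one_add_diagonal_mul]
  have hsub : ∀ S : Finset σ, (y • A.map (algebraMap ℝ ℂ) + B.map (algebraMap ℝ ℂ)).submatrix
      (Subtype.val : S → σ) (Subtype.val : S → σ) =
      y • (A.map (algebraMap ℝ ℂ)).submatrix (Subtype.val : S → σ) (Subtype.val : S → σ) +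
        (B.map (algebraMap ℝ ℂ)).submatrix (Subtype.val : S → σ) (Subtype.val : S → σ) := fun S => rfl
  have hterm : ∀ S : Finset σ, (y + 1) ^ (Fintype.card σ - S.card) * (∏ i ∈ S, z i) *
      ((y • A.map (algebraMap ℝ ℂ) + B.map (algebraMap ℝ ℂ)).submatrix
        (Subtype.val : S → σ) (Subtype.val : S → σ)).det =
      (∏ i ∈ S, z i) * ∑ j ∈ range (Fintype.card σ + 1), (layerWeight A B j S : ℂ) * y ^ j := by
    intro S
    rw [sum_layerWeight_mul_pow, aeval_minorPencil, hsub, add_comm y 1]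
    ring
  simp_rw [hterm]
  have hlhs : eval (fun o => Option.elim o y z) (MvPolynomial.map (algebraMap ℝ ℂ) (layerPoly A B)) =
      ∑ j ∈ range (Fintype.card σ + 1), y ^ j * ∑ S : Finset σ, (layerWeight A B j S : ℂ) * ∏ i ∈ S, z i := by
    rw [layerPoly, map_sum, map_sum]
    refine Finset.sum_congr rfl fun j _ => ?_
    rw [map_mul, map_pow, map_X, map_rename, map_multiAffine, eval_mul, eval_pow, eval_X, eval_rename,
      eval_multiAffine]
    simp only [Option.elim_none, Function.comp_apply, Option.elim_some, Complex.coe_algebraMap]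
  rw [hlhs]
  simp_rw [Finset.mul_sum]
  rw [Finset.sum_comm]
  refine Finset.sum_congr rfl fun S _ => Finset.sum_congr rfl fun j _ => ?_
  ring

omit [Fintype σ] [DecidableEq σ] in
/-- Coordinates `(z, y)` of a point of `ℂ^{n+1}`. [folklore] -/
private theorem dsd_option_elim_eq (w : Option σ → ℂ) : (fun o => Option.elim o (w none) (w ∘ some)) = w := by
  funext o; cases o <;> rfl

/-- The coefficient matrices of the auxiliary affine pencil `diag(w) + s(B - A) + A`: `E_jj` for `w_j`, `B - A` for
`s`. [cite: BorceaBrandenLiggett2007, §4.3.1 proof of Prop. 4.15 ("By Proposition 3.2 the polynomial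
`det(A + y(B - A) + Z)` is real stable")] -/
def auxFamily : Option σ → Matrix σ σ ℂ := fun o =>
  Option.elim o (B.map (algebraMap ℝ ℂ) - A.map (algebraMap ℝ ℂ)) fun j => diagonal (Pi.single j 1)

omit [DecidableEq σ] in
/-- A real positive semidefinite matrix stays positive semidefinite over `ℂ` (`x* M x = uᵀ M u + wᵀ M w` for
`x = u + i w`). [folklore] -/
private theorem dsd_posSemidef_map_ofReal {M : Matrix σ σ ℝ} (hM : M.PosSemidef) :
    (M.map (algebraMap ℝ ℂ)).PosSemidef := by
  have hH : (M.map (algebraMap ℝ ℂ)).IsHermitian := hM.1.map (algebraMap ℝ ℂ) (fun r => by simp)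
  refine PosSemidef.of_dotProduct_mulVec_nonneg hH fun x => ?_
  set u : σ → ℝ := fun p => (x p).re with hu
  set w : σ → ℝ := fun p => (x p).im with hw
  have hyre : ∀ p, ((M.map (algebraMap ℝ ℂ) *ᵥ x) p).re = (M *ᵥ u) p := fun p => by
    simp only [mulVec, dotProduct, map_apply, Complex.re_sum, Complex.coe_algebraMap, Complex.re_ofReal_mul, hu]
  have hyim : ∀ p, ((M.map (algebraMap ℝ ℂ) *ᵥ x) p).im = (M *ᵥ w) p := fun p => by
    simp only [mulVec, dotProduct, map_apply, Complex.im_sum, Complex.coe_algebraMap, Complex.im_ofReal_mul, hw]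
  have hre : (star x ⬝ᵥ (M.map (algebraMap ℝ ℂ) *ᵥ x)).re = u ⬝ᵥ (M *ᵥ u) + w ⬝ᵥ (M *ᵥ w) := by
    rw [dotProduct, Complex.re_sum, dotProduct, dotProduct, ← Finset.sum_add_distrib]
    refine Finset.sum_congr rfl fun p _ => ?_
    rw [Complex.mul_re, hyre, hyim, Pi.star_apply, Complex.star_def, Complex.conj_re, Complex.conj_im]
    simp only [hu, hw]
    ring
  have him : (star x ⬝ᵥ (M.map (algebraMap ℝ ℂ) *ᵥ x)).im = 0 := hH.im_star_dotProduct_mulVec_self x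
  have hval : star x ⬝ᵥ (M.map (algebraMap ℝ ℂ) *ᵥ x) = ((u ⬝ᵥ (M *ᵥ u) + w ⬝ᵥ (M *ᵥ w) : ℝ) : ℂ) :=
    Complex.ext (by rw [hre, Complex.ofReal_re]) (by rw [him, Complex.ofReal_im])
  rw [hval, Complex.zero_le_real]
  exact add_nonneg (hM.dotProduct_mulVec_nonneg u) (hM.dotProduct_mulVec_nonneg w)

/-- The coefficient matrices are positive semidefinite when `A ≤ B`. [cite: BorceaBrandenLiggett2007, §4.3.1 proof
of Prop. 4.15] -/
theorem posSemidef_auxFamily (hAB : (B - A).PosSemidef) (o : Option σ) : (auxFamily A B o).PosSemidef := by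
  rcases o with _ | j
  · have h := dsd_posSemidef_map_ofReal hAB
    rw [Matrix.map_sub _ (map_sub (algebraMap ℝ ℂ))] at h
    exact h
  · change (diagonal (Pi.single j (1 : ℂ))).PosSemidef
    rw [posSemidef_diagonal_iff]
    intro i
    rcases eq_or_ne i j with rfl | hij
    · rw [Pi.single_eq_same]; exact zero_le_one
    · rw [Pi.single_eq_of_ne hij]

/-- The factorization behind the inversion–shift argument: with `s = (y+1)⁻¹`, `w_j = z_j⁻¹`,
`(y + 1) I + diag(z)(yA + B) = diag(z) · (-(y+1)) · (Σ_o x_o M_o - A)` for the point `x = (-w, -s)`.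
[cite: BorceaBrandenLiggett2007, §4.3.1 proof of Prop. 4.15 ("`F(z,y) = z_1 ⋯ z_n y^n G(z_1^{-1}, …, y^{-1})`,
`f(z, y) = F(z, y+1)`")] -/
theorem layerMatrix_eq (z : σ → ℂ) (y : ℂ) (hz : ∀ j, z j ≠ 0) (hy : y + 1 ≠ 0) :
    (y + 1) • (1 : Matrix σ σ ℂ) + diagonal z * (y • A.map (algebraMap ℝ ℂ) + B.map (algebraMap ℝ ℂ)) =
      diagonal z * ((-(y + 1)) • (∑ o, (fun o => Option.elim o (-(y + 1)⁻¹) fun j => -(z j)⁻¹) o • auxFamily A B o +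
        -A.map (algebraMap ℝ ℂ))) := by
  rw [Fintype.sum_option]
  simp only [Option.elim_none, Option.elim_some, auxFamily]
  have hdiag : ∑ j, (-(z j)⁻¹) • diagonal (Pi.single j (1 : ℂ)) = diagonal fun j => -(z j)⁻¹ := by
    ext p q
    simp only [Matrix.sum_apply, Matrix.smul_apply, diagonal_apply, Pi.single_apply, smul_eq_mul, mul_ite, mul_one,
      mul_zero]
    by_cases hpq : p = q
    · subst hpq
      simp
    · simp [hpq]
  rw [hdiag]
  ext p q
  simp only [Matrix.add_apply, Matrix.smul_apply, Matrix.one_apply, Matrix.mul_apply, diagonal_apply, Matrix.sub_apply,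
    Matrix.map_apply, Matrix.neg_apply, smul_eq_mul, ite_mul, zero_mul, Finset.sum_ite_eq, Finset.mem_univ, if_true]
  have hzp : z p ≠ 0 := hz p
  by_cases hpq : p = q
  · subst hpq
    simp only [if_true]
    field_simp
    ring
  · simp only [if_neg hpq]
    field_simp
    ring

/-- **`f(z, y) ≠ 0` on `ℋ^{n+1}`**: the auxiliary pencil has trivial kernel at points of `(-ℋ)^{n+1}` — the tree's
kernel lemma `pencil_mulVec_eq_zero_imp` for Prop. 3.2, applied at the conjugate-sign point, forces `E_jj v = 0` for
all `j`. [cite: BorceaBrandenLiggett2007, §4.3.1 proof of Prop. 4.15 ("`f(z, y)` … is real stable")] -/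
theorem isRealStable_layerPoly (hA : A.PosSemidef) (hAB : (B - A).PosSemidef) : IsRealStable (layerPoly A B) := by
  intro w hw
  rw [← dsd_option_elim_eq w, eval_layerPoly]
  set z : σ → ℂ := w ∘ some with hzdef
  set y : ℂ := w none with hydef
  have hz : ∀ j, z j ≠ 0 := fun j h => by
    have := hw (some j); rw [show w (some j) = z j from rfl, h, Complex.zero_im] at this; exact lt_irrefl _ this
  have hy1 : 0 < (y + 1).im := by rw [Complex.add_im, Complex.one_im, add_zero]; exact hw none
  have hy : y + 1 ≠ 0 := fun h => by rw [h, Complex.zero_im] at hy1; exact lt_irrefl _ hy1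
  rw [layerMatrix_eq A B z y hz hy, det_mul, det_smul, det_diagonal]
  refine mul_ne_zero (Finset.prod_ne_zero_iff.2 fun j _ => hz j) (mul_ne_zero (pow_ne_zero _ (neg_ne_zero.2 hy)) ?_)
  -- the kernel argument
  intro hdet
  obtain ⟨v, hv0, hv⟩ := Matrix.exists_mulVec_eq_zero_iff.2 hdet
  have hx : ∀ o : Option σ, 0 < ((fun o => Option.elim o (-(y + 1)⁻¹) fun j => -(z j)⁻¹ : Option σ → ℂ) o).im := by
    rintro (_ | j)
    · simp only [Option.elim_none, Complex.neg_im, Complex.inv_im, neg_div, neg_neg]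
      exact div_pos hy1 (Complex.normSq_pos.2 hy)
    · simp only [Option.elim_some, Complex.neg_im, Complex.inv_im, neg_div, neg_neg]
      exact div_pos (hw (some j)) (Complex.normSq_pos.2 (hz j))
  have hAh : (-A.map (algebraMap ℝ ℂ)).IsHermitian := (dsd_posSemidef_map_ofReal hA).1.neg
  obtain ⟨hker, -⟩ := pencil_mulVec_eq_zero_imp (posSemidef_auxFamily A B hAB) hAh hx hv
  apply hv0
  funext j
  have := congrFun (hker (some j)) j
  simpa [auxFamily, mulVec_diagonal] using this

end Stability

/-! ## §4 `det(y A' + B')` has non-negative coefficients for positive semidefinite `A', B'` -/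

section NonnegCoeff

variable {m : Type*} [Fintype m] [DecidableEq m]

/-- Evaluating `det(X A' + B')` at a complex number. [cite: BorceaBrandenLiggett2007, §4.3.1 proof of Prop. 4.15] -/
theorem aeval_det_X_smul_add (A' B' : Matrix m m ℝ) (t : ℂ) :
    Polynomial.aeval t (((Polynomial.X : Polynomial ℝ) • A'.map Polynomial.C + B'.map Polynomial.C).det) =
      (t • A'.map (algebraMap ℝ ℂ) + B'.map (algebraMap ℝ ℂ)).det := by
  rw [AlgHom.map_det]
  congr 1
  ext p q
  simp only [AlgHom.mapMatrix_apply, Matrix.map_apply, Matrix.add_apply, Matrix.smul_apply, smul_eq_mul, map_add,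
    map_mul, Polynomial.aeval_X, Polynomial.aeval_C, Complex.coe_algebraMap]

/-- A common kernel vector of `A'` and `B'` kills `det(X A' + B')`. [cite: BorceaBrandenLiggett2007, §4.3.1 proof
of Prop. 4.15] -/
theorem det_X_smul_add_eq_zero_of_common_kernel (A' B' : Matrix m m ℝ) {v : m → ℂ} (hv : v ≠ 0)
    (hA : A'.map (algebraMap ℝ ℂ) *ᵥ v = 0) (hB : B'.map (algebraMap ℝ ℂ) *ᵥ v = 0) :
    ((Polynomial.X : Polynomial ℝ) • A'.map Polynomial.C + B'.map Polynomial.C).det = 0 := by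
  set p := ((Polynomial.X : Polynomial ℝ) • A'.map Polynomial.C + B'.map Polynomial.C).det with hp
  have hmap : p.map (algebraMap ℝ ℂ) = 0 := by
    refine Polynomial.funext fun t => ?_
    rw [Polynomial.eval_map, ← Polynomial.aeval_def, hp, aeval_det_X_smul_add, Polynomial.eval_zero]
    refine (Matrix.exists_mulVec_eq_zero_iff).1 ⟨v, hv, ?_⟩
    rw [add_mulVec, smul_mulVec, hA, hB, smul_zero, add_zero]
  exact (Polynomial.map_eq_zero_iff (RingHom.injective _)).1 hmap

/-- **Zeros of `det(y A' + B')` are real and non-positive** (unless the polynomial vanishes): at a zero `ζ` some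
`v ≠ 0` has `ζ · v*A'v + v*B'v = 0` with `v*A'v > 0`. [cite: BorceaBrandenLiggett2007, §4.3.1 proof of Prop. 4.15
(with Prop. 3.2)] -/
theorem root_det_X_smul_add {A' B' : Matrix m m ℝ} (hA : A'.PosSemidef) (hB : B'.PosSemidef)
    (hp : ((Polynomial.X : Polynomial ℝ) • A'.map Polynomial.C + B'.map Polynomial.C).det ≠ 0) {ζ : ℂ}
    (hζ : Polynomial.aeval ζ (((Polynomial.X : Polynomial ℝ) • A'.map Polynomial.C + B'.map Polynomial.C).det) = 0) :
    ζ.im = 0 ∧ ζ.re ≤ 0 := by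
  rw [aeval_det_X_smul_add] at hζ
  obtain ⟨v, hv0, hv⟩ := Matrix.exists_mulVec_eq_zero_iff.2 hζ
  have hAc := dsd_posSemidef_map_ofReal hA
  have hBc := dsd_posSemidef_map_ofReal hB
  set a : ℂ := star v ⬝ᵥ (A'.map (algebraMap ℝ ℂ) *ᵥ v) with ha
  set b : ℂ := star v ⬝ᵥ (B'.map (algebraMap ℝ ℂ) *ᵥ v) with hb
  have hq : ζ * a + b = 0 := by
    have := congrArg (fun w => star v ⬝ᵥ w) hv
    simpa only [add_mulVec, smul_mulVec, dotProduct_add, dotProduct_smul, smul_eq_mul, dotProduct_zero] using this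
  have haim : a.im = 0 := hAc.1.im_star_dotProduct_mulVec_self v
  have hbim : b.im = 0 := hBc.1.im_star_dotProduct_mulVec_self v
  have hare : 0 ≤ a.re := hAc.re_dotProduct_nonneg v
  have hbre : 0 ≤ b.re := hBc.re_dotProduct_nonneg v
  have ha0 : a ≠ 0 := by
    intro ha0
    have hAv : A'.map (algebraMap ℝ ℂ) *ᵥ v = 0 := (hAc.dotProduct_mulVec_zero_iff v).1 ha0
    have hb0 : b = 0 := by rw [ha0, mul_zero, zero_add] at hq; exact hq
    have hBv : B'.map (algebraMap ℝ ℂ) *ᵥ v = 0 := (hBc.dotProduct_mulVec_zero_iff v).1 hb0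
    exact hp (det_X_smul_add_eq_zero_of_common_kernel A' B' hv0 hAv hBv)
  have hare' : 0 < a.re := by
    rcases hare.lt_or_eq with h | h
    · exact h
    · exact absurd (Complex.ext h.symm haim) ha0
  have hζ' : ζ = -b / a := by field_simp; linear_combination hq
  have hζre : ζ.re = -b.re / a.re := by
    rw [hζ', ← Complex.re_add_im a, ← Complex.re_add_im b, haim, hbim]
    simp
  have hζim : ζ.im = 0 := by
    rw [hζ', ← Complex.re_add_im a, ← Complex.re_add_im b, haim, hbim]
    simp
  exact ⟨hζim, by rw [hζre]; exact div_nonpos_of_nonpos_of_nonneg (neg_nonpos.2 hbre) hare'.le⟩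

/-- **`det(y A' + B') ∈ ℝ[y]` has non-negative coefficients for positive semidefinite `A', B'`** (all its zeros
are real `≤ 0` and its value at `y = 1` is `det(A' + B') > 0`; BBL: "`f(z, y)` … is real stable with non-negative
coefficients"). [cite: BorceaBrandenLiggett2007, §4.3.1 proof of Prop. 4.15] -/
theorem coeff_det_X_smul_add_nonneg {A' B' : Matrix m m ℝ} (hA : A'.PosSemidef) (hB : B'.PosSemidef) (k : ℕ) :
    0 ≤ (((Polynomial.X : Polynomial ℝ) • A'.map Polynomial.C + B'.map Polynomial.C).det).coeff k := by
  set p := ((Polynomial.X : Polynomial ℝ) • A'.map Polynomial.C + B'.map Polynomial.C).det with hp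
  by_cases hp0 : p = 0
  · rw [hp0, Polynomial.coeff_zero]
  set q : Polynomial ℂ := p.map (algebraMap ℝ ℂ) with hq
  have hq0 : q ≠ 0 := fun h => hp0 ((Polynomial.map_eq_zero_iff (RingHom.injective _)).1 h)
  have hroots : ∀ ζ, q.IsRoot ζ → ζ.im = 0 ∧ ζ.re ≤ 0 := by
    intro ζ hζ
    rw [Polynomial.IsRoot, hq, Polynomial.eval_map, ← Polynomial.aeval_def] at hζ
    exact root_det_X_smul_add hA hB hp0 hζ
  obtain ⟨u, hu1, hu⟩ := exists_unit_mul_coeff_nonneg_of_roots_nonpos hq0 hroots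
  -- the value at `1`
  have hval : q.eval 1 = ((p.eval 1 : ℝ) : ℂ) := by
    rw [hq, Polynomial.eval_map, show (1 : ℂ) = algebraMap ℝ ℂ 1 from (map_one _).symm, Polynomial.eval₂_hom]
    rfl
  have hpos : 0 < p.eval 1 := by
    have hne : p.eval 1 ≠ 0 := by
      intro h0
      have h1 : q.IsRoot 1 := by rw [Polynomial.IsRoot, hval, h0, Complex.ofReal_zero]
      have := (hroots 1 h1).2
      rw [Complex.one_re] at this
      linarith
    have hge : 0 ≤ p.eval 1 := by
      have hmapadd : (A' + B').map (algebraMap ℝ ℂ) = A'.map (algebraMap ℝ ℂ) + B'.map (algebraMap ℝ ℂ) :=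
        Matrix.map_add _ (map_add (algebraMap ℝ ℂ)) A' B'
      have h1 : Polynomial.aeval (1 : ℂ) p = ((A' + B').map (algebraMap ℝ ℂ)).det := by
        rw [hp, aeval_det_X_smul_add, one_smul, hmapadd]
      have h1' : Polynomial.aeval (1 : ℂ) p = ((p.eval 1 : ℝ) : ℂ) := by
        rw [Polynomial.aeval_def, ← Polynomial.eval_map, ← hq, hval]
      have hdet := (dsd_posSemidef_map_ofReal (hA.add hB)).det_nonneg
      rw [← h1, h1', Complex.zero_le_real] at hdet
      exact hdet
    exact lt_of_le_of_ne hge (Ne.symm hne)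
  -- `u · q(1) = Σ_k u · [y^k] q` is real and non-negative, so `u = 1`
  have hsum : u * q.eval 1 = ∑ k ∈ range (q.natDegree + 1), u * q.coeff k := by
    rw [Polynomial.eval_eq_sum_range, Finset.mul_sum]
    simp only [one_pow, mul_one]
  have huim : (u * q.eval 1).im = 0 := by
    rw [hsum, Complex.im_sum]
    exact Finset.sum_eq_zero fun k _ => (hu k).1
  have hure : 0 ≤ (u * q.eval 1).re := by
    rw [hsum, Complex.re_sum]
    exact Finset.sum_nonneg fun k _ => (hu k).2
  simp only [hval, Complex.mul_im, Complex.ofReal_re, Complex.ofReal_im, mul_zero, zero_add] at huim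
  simp only [hval, Complex.mul_re, Complex.ofReal_re, Complex.ofReal_im, mul_zero, sub_zero] at hure
  have huim' : u.im = 0 := (mul_eq_zero.1 huim).resolve_right hpos.ne'
  have hure' : 0 ≤ u.re := by
    by_contra hneg
    push Not at hneg
    have : Polynomial.eval 1 p * u.re < 0 := mul_neg_of_pos_of_neg hpos hneg
    linarith
  have hu_one : u = 1 := by
    have hn : ‖u‖ ^ 2 = u.re ^ 2 := by
      rw [Complex.sq_norm, Complex.normSq_apply, huim', mul_zero, add_zero, sq]
    rw [hu1, one_pow] at hn
    have hre1 : u.re = 1 := by nlinarith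
    exact Complex.ext (by rw [hre1, Complex.one_re]) (by rw [huim', Complex.one_im])
  have := (hu k).2
  rw [hu_one, one_mul, hq, Polynomial.coeff_map, Complex.coe_algebraMap, Complex.ofReal_re] at this
  exact this

end NonnegCoeff

/-! ## §5 The layers `P_{n-j} = Σ_S w_j(S) z^S`: identification, signs, proper position -/

section Layers

variable (A B : Matrix σ σ ℝ)

omit [Fintype σ] [DecidableEq σ] in
/-- `optionEquivLeft` sends a polynomial in the old variables to a constant. [folklore] -/
private theorem dsd_optionEquivLeft_rename_some (g : MvPolynomial σ ℝ) :
    optionEquivLeft ℝ σ (rename some g) = Polynomial.C g := by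
  induction g using MvPolynomial.induction_on with
  | C a => rw [rename_C, optionEquivLeft_C]
  | add p q hp hq => rw [map_add, map_add, hp, hq, map_add]
  | mul_X p j hp => rw [map_mul, rename_X, map_mul, hp, optionEquivLeft_X_some, map_mul]

omit [DecidableEq σ] in
/-- `multiAffine 0 = 0`. [folklore] -/
private theorem dsd_multiAffine_zero : multiAffine (0 : Finset σ → ℝ) = 0 := by
  simp [multiAffine]

omit [DecidableEq σ] in
/-- `multiAffine (c • w) = C c · multiAffine w`. [folklore] -/
private theorem dsd_multiAffine_smul (c : ℝ) (w : Finset σ → ℝ) :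
    multiAffine (fun S => c * w S) = C c * multiAffine w := by
  simp only [multiAffine, Finset.mul_sum, C_mul, mul_assoc]

/-- **The `y^j`-coefficient of `f` is `Σ_S w_j(S) z^S`.** [cite: BorceaBrandenLiggett2007, §4.3.1 proof of
Prop. 4.15 ("`f(z,y) = y^n P_0(z) + y^{n-1} P_1(z) + ⋯ + P_n(z)`")] -/
theorem coeff_optionEquivLeft_layerPoly (j : ℕ) :
    (optionEquivLeft ℝ σ (layerPoly A B)).coeff j = multiAffine (layerWeight A B j) := by
  rw [layerPoly, map_sum, Polynomial.finsetSum_coeff]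
  simp_rw [map_mul, map_pow, optionEquivLeft_X_none, dsd_optionEquivLeft_rename_some, mul_comm (Polynomial.X ^ _),
    Polynomial.coeff_C_mul_X_pow]
  rw [Finset.sum_ite_eq]
  split_ifs with hj
  · rfl
  · rw [layerWeight_eq_zero_of_lt A B (by simpa using hj), dsd_multiAffine_zero]

/-- **Non-negativity of the layer weights**: `w_j(S) ≥ 0`, being a coefficient of
`(1+y)^{n-|S|} det(y A[S] + B[S])` with `A[S], B[S] ⪰ 0`. [cite: BorceaBrandenLiggett2007, §4.3.1 proof of
Prop. 4.15 ("real stable with non-negative coefficients")] -/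
theorem layerWeight_nonneg (hA : A.PosSemidef) (hAB : (B - A).PosSemidef) (j : ℕ) (S : Finset σ) :
    0 ≤ layerWeight A B j S := by
  have hB : B.PosSemidef := by
    have h : B = A + (B - A) := by abel
    rw [h]; exact hA.add hAB
  rw [layerWeight, minorPencil, Polynomial.coeff_mul]
  refine Finset.sum_nonneg fun kl _ => mul_nonneg ?_ ?_
  · rw [Polynomial.coeff_one_add_X_pow]; exact Nat.cast_nonneg _
  · exact coeff_det_X_smul_add_nonneg (hA.submatrix _) (hB.submatrix _) _

/-- `w_j ≠ 0` for `j ≤ n` (look at `S = ∅`). [cite: BorceaBrandenLiggett2007, §4.3.1 proof of Prop. 4.15] -/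
theorem multiAffine_layerWeight_ne_zero {j : ℕ} (hj : j ≤ Fintype.card σ) : multiAffine (layerWeight A B j) ≠ 0 := by
  intro h
  have h0 := eq_zero_of_multiAffine_eq_zero h ∅
  rw [layerWeight_empty] at h0
  exact (Nat.choose_pos hj).ne' (by exact_mod_cast h0)

/-- `0 < Σ_S w_j(S)` for `j ≤ n`. [cite: BorceaBrandenLiggett2007, §4.3.1 proof of Prop. 4.15] -/
theorem mass_layerWeight_pos (hA : A.PosSemidef) (hAB : (B - A).PosSemidef) {j : ℕ} (hj : j ≤ Fintype.card σ) :
    0 < mass (layerWeight A B j) := by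
  rw [mass]
  calc (0 : ℝ) < layerWeight A B j ∅ := by
        rw [layerWeight_empty]; exact_mod_cast Nat.choose_pos hj
    _ ≤ ∑ S, layerWeight A B j S :=
        Finset.single_le_sum (fun S _ => layerWeight_nonneg A B hA hAB j S) (Finset.mem_univ _)

/-- **The chain step `P_{k} ≪ P_{k+1}`**: consecutive layers are in proper position,
`Σ_S w_{j+1}(S) z^S ≪ Σ_S w_j(S) z^S` (Remark 4.1 on `∂_y^j f`, tree
`IsRealStable.coeff_optionEquivLeft_properPosition`; the degenerate alternative is excluded by `w_j(∅) = C(n,j) ≠ 0`).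
[cite: BorceaBrandenLiggett2007, §4.3.1 proof of Prop. 4.15 ("by Remark 4.1 we have that
`P_0 ≪ P_1 ≪ ⋯ ≪ P_n`")] -/
theorem isProperPosition_layerWeight (hA : A.PosSemidef) (hAB : (B - A).PosSemidef) {j : ℕ}
    (hj : j ≤ Fintype.card σ) :
    IsProperPosition (multiAffine (layerWeight A B (j + 1))) (multiAffine (layerWeight A B j)) := by
  rcases (isRealStable_layerPoly A B hA hAB).coeff_optionEquivLeft_properPosition j with ⟨-, h0⟩ | h
  · rw [coeff_optionEquivLeft_layerPoly] at h0
    exact absurd h0 (multiAffine_layerWeight_ne_zero A B hj)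
  · rwa [coeff_optionEquivLeft_layerPoly, coeff_optionEquivLeft_layerPoly] at h

/-- Each layer is strongly Rayleigh (a real stable generating polynomial) for `j ≤ n`.
[cite: BorceaBrandenLiggett2007, §4.3.1 proof of Prop. 4.15] -/
theorem isRealStable_multiAffine_layerWeight (hA : A.PosSemidef) (hAB : (B - A).PosSemidef) {j : ℕ}
    (hj : j ≤ Fintype.card σ) : IsRealStable (multiAffine (layerWeight A B j)) :=
  ((isProperPosition_layerWeight A B hA hAB hj).eq_zero_or_isRealStable_right).resolve_left
    (multiAffine_layerWeight_ne_zero A B hj)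

/-- The normalized layer `w_j / Σ w_j`. [cite: BorceaBrandenLiggett2007, §4.3.1 proof of Prop. 4.15] -/
def layerLaw (j : ℕ) : Finset σ → ℝ := fun S => layerWeight A B j S / mass (layerWeight A B j)

/-- The normalized principal-minor law `S ↦ det M[S] / det(I + M)` ("the measure with generating polynomial
`det(I + AZ)/det(I + A)`"). [cite: BorceaBrandenLiggett2007, §4.3.1 Prop. 4.15] -/
def minorLaw (M : Matrix σ σ ℝ) : Finset σ → ℝ := fun S => minorWeight M S / mass (minorWeight M)

/-- Unfolding `layerLaw`. [cite: BorceaBrandenLiggett2007, §4.3.1 proof of Prop. 4.15] -/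
theorem layerLaw_apply (j : ℕ) (S : Finset σ) : layerLaw A B j S = layerWeight A B j S / mass (layerWeight A B j) :=
  rfl

/-- Unfolding `minorLaw`. [cite: BorceaBrandenLiggett2007, §4.3.1 Prop. 4.15] -/
theorem minorLaw_apply (M : Matrix σ σ ℝ) (S : Finset σ) : minorLaw M S = minorWeight M S / mass (minorWeight M) :=
  rfl

/-- Top layer, normalized: the `A`-law. [cite: BorceaBrandenLiggett2007, §4.3.1 proof of Prop. 4.15] -/
theorem layerLaw_card : layerLaw A B (Fintype.card σ) = minorLaw A := by
  funext S; rw [layerLaw_apply, minorLaw_apply, layerWeight_card]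

/-- Bottom layer, normalized: the `B`-law. [cite: BorceaBrandenLiggett2007, §4.3.1 proof of Prop. 4.15] -/
theorem layerLaw_zero : layerLaw A B 0 = minorLaw B := by
  funext S; rw [layerLaw_apply, minorLaw_apply, layerWeight_zero]

omit [DecidableEq σ] in
/-- Mass of a normalized weight. [folklore] -/
private theorem dsd_mass_normalize {w : Finset σ → ℝ} (hw : 0 < mass w) : mass (fun S => w S / mass w) = 1 := by
  rw [mass]
  simp_rw [div_eq_mul_inv]
  rw [← Finset.sum_mul, ← mass, mul_inv_cancel₀ hw.ne']

omit [DecidableEq σ] in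
/-- Generating polynomial of a normalized weight. [folklore] -/
private theorem dsd_multiAffine_normalize (w : Finset σ → ℝ) :
    multiAffine (fun S => w S / mass w) = C (mass w)⁻¹ * multiAffine w := by
  rw [← dsd_multiAffine_smul]
  congr 1
  funext S
  rw [div_eq_inv_mul]

/-- **One link of the chain**: `layerLaw (j+1) → layerLaw j` is an `SRStep` (both are strongly Rayleigh probability
measures and their generating polynomials are in proper position). [cite: BorceaBrandenLiggett2007, §4.3.1 proof
of Prop. 4.15] -/
theorem srStep_layerLaw (hA : A.PosSemidef) (hAB : (B - A).PosSemidef) {j : ℕ} (hj : j + 1 ≤ Fintype.card σ) :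
    SRStep (layerLaw A B (j + 1)) (layerLaw A B j) := by
  have hj' : j ≤ Fintype.card σ := (Nat.le_succ j).trans hj
  have hm1 := mass_layerWeight_pos A B hA hAB hj
  have hm0 := mass_layerWeight_pos A B hA hAB hj'
  refine ⟨⟨fun S => div_nonneg (layerWeight_nonneg A B hA hAB _ S) hm1.le, dsd_mass_normalize hm1⟩,
    ⟨fun S => div_nonneg (layerWeight_nonneg A B hA hAB _ S) hm0.le, dsd_mass_normalize hm0⟩, ?_⟩
  change IsProperPosition (multiAffine fun S => layerWeight A B (j + 1) S / mass (layerWeight A B (j + 1)))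
    (multiAffine fun S => layerWeight A B j S / mass (layerWeight A B j))
  rw [dsd_multiAffine_normalize, dsd_multiAffine_normalize,
    isProperPosition_C_mul_iff (inv_pos.2 hm1) (inv_pos.2 hm0)]
  exact isProperPosition_layerWeight A B hA hAB hj'

omit [DecidableEq σ] in
/-- Transitivity of `⊴′`. [cite: BorceaBrandenLiggett2007, §4.3.1 Def. 4.1] -/
theorem SRLe'.trans {μ ν ρ : Finset σ → ℝ} (h₁ : SRLe' μ ν) (h₂ : SRLe' ν ρ) : SRLe' μ ρ :=
  ⟨h₁.1, h₁.2.trans h₂.2⟩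

/-- **The chain** `layerLaw j ⊴′ layerLaw 0` for `j ≤ n`. [cite: BorceaBrandenLiggett2007, §4.3.1 proof of
Prop. 4.15 ("`P_0 ≪ P_1 ≪ ⋯ ≪ P_n`")] -/
theorem srLe'_layerLaw (hA : A.PosSemidef) (hAB : (B - A).PosSemidef) {j : ℕ} (hj : j ≤ Fintype.card σ) :
    SRLe' (layerLaw A B j) (layerLaw A B 0) := by
  induction j with
  | zero =>
    have hm0 := mass_layerWeight_pos A B hA hAB hj
    refine ⟨⟨fun S => div_nonneg (layerWeight_nonneg A B hA hAB _ S) hm0.le, dsd_mass_normalize hm0, ?_⟩,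
      Relation.ReflTransGen.refl⟩
    rw [stableOrZero_iff]
    right
    change IsRealStable (multiAffine fun S => layerWeight A B 0 S / mass (layerWeight A B 0))
    rw [dsd_multiAffine_normalize, isRealStable_C_mul_iff (inv_ne_zero hm0.ne')]
    exact isRealStable_multiAffine_layerWeight A B hA hAB hj
  | succ j ih => exact (srStep_layerLaw A B hA hAB hj).srLe'.trans (ih ((Nat.le_succ j).trans hj))

end Layers

/-! ## §6 Proposition 4.15 -/

section Prop415

variable {A B : Matrix σ σ ℝ}

/-- **Borcea–Brändén–Liggett, Proposition 4.15 (first display).** "Let `A` and `B` be positive semi-definite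
`n × n` matrices. If `A ≤ B` then `det(I + AZ)/det(I + A) ⊴ det(I + BZ)/det(I + B)`": the normalized
principal-minor laws satisfy `minorLaw A ⊴′ minorLaw B` (a finite chain of proper-position steps through strongly
Rayleigh probability measures — so a fortiori `⊴`). [cite: BorceaBrandenLiggett2007, §4.3.1 Prop. 4.15] -/
theorem BorceaBrandenLiggett_prop_4_15 (hA : A.PosSemidef) (hAB : (B - A).PosSemidef) :
    SRLe' (minorLaw A) (minorLaw B) := by
  rw [← layerLaw_card A B, ← layerLaw_zero A B]
  exact srLe'_layerLaw A B hA hAB le_rfl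

/-- Proposition 4.15, first display, in the closed order `⊴`. [cite: BorceaBrandenLiggett2007, §4.3.1 Prop. 4.15] -/
theorem BorceaBrandenLiggett_prop_4_15_srLe (hA : A.PosSemidef) (hAB : (B - A).PosSemidef) :
    SRLe (minorLaw A) (minorLaw B) :=
  (BorceaBrandenLiggett_prop_4_15 hA hAB).srLe

/-- **Proposition 4.15 with Proposition 4.12**: `minorLaw A ≼ minorLaw B` (stochastic domination by an increasing
coupling, tree `StochDom`). [cite: BorceaBrandenLiggett2007, §4.3.1 Prop. 4.15 with Prop. 4.12] -/
theorem stochDom_minorLaw (hA : A.PosSemidef) (hAB : (B - A).PosSemidef) : StochDom (minorLaw A) (minorLaw B) :=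
  (BorceaBrandenLiggett_prop_4_15_srLe hA hAB).stochDom

/-- Expectations of increasing functions: `E_{minorLaw A} F ≤ E_{minorLaw B} F`.
[cite: BorceaBrandenLiggett2007, §4.3.1 Prop. 4.15 with Prop. 4.12] -/
theorem ex_minorLaw_le (hA : A.PosSemidef) (hAB : (B - A).PosSemidef) {F : Finset σ → ℝ} (hF : Monotone F) :
    ex (minorLaw A) F ≤ ex (minorLaw B) F :=
  (BorceaBrandenLiggett_prop_4_15 hA hAB).ex_le_ex hF

end Prop415

/-! ## §7 Theorem 4.13: determinantal measures with comparable positive contractions -/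

section Thm413

variable {A B : Matrix σ σ ℝ}

/-- A determinantal weight has total mass `1` (`S = ∅` in the defining identity). [cite: BorceaBrandenLiggett2007,
§3.3 ("a positive contraction [defines] a determinantal probability measure")] -/
theorem IsDeterminantal.mass_eq_one {μ : Finset σ → ℝ} {K : Matrix σ σ ℂ} (h : IsDeterminantal μ K) : mass μ = 1 := by
  have h0 := h ∅
  haveI : IsEmpty ((∅ : Finset σ) : Type _) := ⟨fun x => (Finset.notMem_empty _ x.2).elim⟩
  rw [Matrix.det_isEmpty, Finset.filter_true_of_mem fun T _ => Finset.empty_subset T] at h0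
  rw [mass]
  exact_mod_cast h0

omit [DecidableEq σ] in
/-- `multiAffine` is injective on real weights. [folklore] -/
private theorem dsd_multiAffine_injective {a b : Finset σ → ℝ} (h : multiAffine a = multiAffine b) : a = b := by
  have hsub : multiAffine (a - b) = 0 := by
    have : multiAffine (a - b) = multiAffine a - multiAffine b := by
      simp only [multiAffine, Pi.sub_apply, C_sub, sub_mul, Finset.sum_sub_distrib]
    rw [this, h, sub_self]
  funext S
  have := eq_zero_of_multiAffine_eq_zero hsub S
  rwa [Pi.sub_apply, sub_eq_zero] at this

omit [DecidableEq σ] in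
/-- Two real weights with the same generating function on `ℂ^σ` coincide. [folklore] -/
private theorem dsd_eq_of_forall_sum_eq {a b : Finset σ → ℝ}
    (h : ∀ z : σ → ℂ, ∑ S : Finset σ, (a S : ℂ) * ∏ i ∈ S, z i = ∑ S : Finset σ, (b S : ℂ) * ∏ i ∈ S, z i) :
    a = b := by
  have hpoly : MvPolynomial.map (algebraMap ℝ ℂ) (multiAffine a) = MvPolynomial.map (algebraMap ℝ ℂ) (multiAffine b) := by
    refine MvPolynomial.funext fun z => ?_
    rw [map_multiAffine, map_multiAffine, eval_multiAffine, eval_multiAffine]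
    simpa only [Function.comp_apply, Complex.coe_algebraMap] using h z
  exact dsd_multiAffine_injective (MvPolynomial.map_injective _ (RingHom.injective _) hpoly)

/-- **`det(I - A + diag(z) A) = det(I + diag(z) A(I-A)⁻¹) · det(I - A)`** for invertible `I - A`
("`det(I - A + AZ) = det(I + A'Z)/det(I + A')`, `A' = A(I-A)⁻¹`"). [cite: BorceaBrandenLiggett2007, §4.3.1
proof of Prop. 4.15 (third display)] -/
theorem det_one_sub_add_diagonal_mul_eq (hA1 : IsUnit (1 - A).det) (z : σ → ℂ) :
    (1 - A.map (algebraMap ℝ ℂ) + diagonal z * A.map (algebraMap ℝ ℂ)).det =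
      (1 + diagonal z * (A * (1 - A)⁻¹).map (algebraMap ℝ ℂ)).det * (((1 - A).det : ℝ) : ℂ) := by
  have hreal : A * (1 - A)⁻¹ * (1 - A) = A := Matrix.nonsing_inv_mul_cancel_right (A := 1 - A) A hA1
  have hC : (A * (1 - A)⁻¹).map (algebraMap ℝ ℂ) * (1 - A.map (algebraMap ℝ ℂ)) = A.map (algebraMap ℝ ℂ) := by
    have := congrArg (fun M : Matrix σ σ ℝ => M.map (algebraMap ℝ ℂ)) hreal
    simp only [Matrix.map_mul] at this
    rwa [Matrix.map_sub _ (map_sub (algebraMap ℝ ℂ)), Matrix.map_one _ (map_zero _) (map_one _), ← Matrix.map_mul]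
      at this
  have hdet1 : (((1 - A).det : ℝ) : ℂ) = (1 - A.map (algebraMap ℝ ℂ)).det := by
    rw [← Complex.coe_algebraMap, RingHom.map_det, RingHom.mapMatrix_apply, Matrix.map_sub _ (map_sub _),
      Matrix.map_one _ (map_zero _) (map_one _)]
  rw [hdet1, ← det_mul, add_mul, one_mul, Matrix.mul_assoc, hC]

/-- **A determinantal weight with kernel `A`, `I - A` invertible, is the normalized principal-minor law of
`A' = A(I-A)⁻¹`**: `μ(S) = det(I - A) · det A'[S]`. [cite: BorceaBrandenLiggett2007, §4.3.1 proof of Prop. 4.15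
("the last ordering is the same as `μ_A ⊴ μ_B`")] -/
theorem IsDeterminantal.eq_det_mul_minorWeight {μ : Finset σ → ℝ} (hμ : IsDeterminantal μ (A.map (algebraMap ℝ ℂ)))
    (hA1 : IsUnit (1 - A).det) : μ = fun S => (1 - A).det * minorWeight (A * (1 - A)⁻¹) S := by
  refine dsd_eq_of_forall_sum_eq fun z => ?_
  rw [hμ.sum_mul_prod, det_one_sub_add_diagonal_mul_eq hA1, ← sum_minorWeight_mul_prod, Finset.sum_mul]
  refine Finset.sum_congr rfl fun S _ => ?_
  push_cast
  ring

/-- … and, `μ` having mass one, `μ = minorLaw A'`. [cite: BorceaBrandenLiggett2007, §4.3.1 proof of Prop. 4.15] -/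
theorem IsDeterminantal.eq_minorLaw {μ : Finset σ → ℝ} (hμ : IsDeterminantal μ (A.map (algebraMap ℝ ℂ)))
    (hA1 : IsUnit (1 - A).det) : μ = minorLaw (A * (1 - A)⁻¹) := by
  have hmass := hμ.mass_eq_one
  have heq := hμ.eq_det_mul_minorWeight hA1
  have hm : (1 - A).det * mass (minorWeight (A * (1 - A)⁻¹)) = 1 := by
    rw [← hmass, heq, mass, mass, Finset.mul_sum]
  have hd : (1 - A).det ≠ 0 := fun h => by rw [h, zero_mul] at hm; exact zero_ne_one hm
  funext S
  rw [heq, minorLaw_apply, eq_div_iff (fun h => by rw [h, mul_zero] at hm; exact zero_ne_one hm)]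
  calc (1 - A).det * minorWeight (A * (1 - A)⁻¹) S * mass (minorWeight (A * (1 - A)⁻¹))
      = minorWeight (A * (1 - A)⁻¹) S * ((1 - A).det * mass (minorWeight (A * (1 - A)⁻¹))) := by ring
    _ = minorWeight (A * (1 - A)⁻¹) S := by rw [hm, mul_one]

/-- `A(I - A)⁻¹ ⪰ 0` for a positive semidefinite strict contraction `A` (`= (I-A)⁻¹ - I`, and `I - A ≤ I`).
[cite: BorceaBrandenLiggett2007, §4.3.1 proof of Prop. 4.15] -/
theorem posSemidef_mul_inv_one_sub (hA : A.PosSemidef) (hA1 : (1 - A).PosDef) : (A * (1 - A)⁻¹).PosSemidef := by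
  rw [Literature.LinearAlgebra.Matrix.mul_inv_one_sub_eq_inv_sub_one ((Matrix.isUnit_iff_isUnit_det _).1 hA1.isUnit)]
  have h := Literature.LinearAlgebra.Matrix.inv_sub_inv_posSemidef_of_posDef (C := 1 - A) (D := 1) hA1
    (by rw [sub_sub_cancel]; exact hA)
  rwa [inv_one] at h

/-- **Borcea–Brändén–Liggett, Theorem 4.13 (with `B < I`)** — the extension of Lyons' theorem to the Loewner
order: "Let `A` and `B` be positive contractions [here real symmetric, `0 ≤ A ≤ B < I`]. If `A ≤ B` then
`μ_A ⊴ μ_B`" — in fact `μ_A ⊴′ μ_B` (a finite chain; BBL: "`μ_A ⊴ μ_B` … by invoking Lemma 4.14 and Proposition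
4.15", the third display of Prop. 4.15 via `A' = A(I-A)⁻¹ ≤ B' = B(I-B)⁻¹`). [cite: BorceaBrandenLiggett2007,
§4.3.1 Thm. 4.13 with Prop. 4.15 (third display) and Lemma 4.14] -/
theorem BorceaBrandenLiggett_thm_4_13 {μ ν : Finset σ → ℝ} (hμ : IsDeterminantal μ (A.map (algebraMap ℝ ℂ)))
    (hν : IsDeterminantal ν (B.map (algebraMap ℝ ℂ))) (hA : A.PosSemidef) (hAB : (B - A).PosSemidef)
    (hB1 : (1 - B).PosDef) : SRLe' μ ν := by
  have hA1 : (1 - A).PosDef := Literature.LinearAlgebra.Matrix.posDef_one_sub_of_le hAB hB1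
  rw [hμ.eq_minorLaw ((Matrix.isUnit_iff_isUnit_det _).1 hA1.isUnit),
    hν.eq_minorLaw ((Matrix.isUnit_iff_isUnit_det _).1 hB1.isUnit)]
  exact BorceaBrandenLiggett_prop_4_15 (posSemidef_mul_inv_one_sub hA hA1)
    (Literature.LinearAlgebra.Matrix.BorceaBrandenLiggett_lemma_4_14 hAB hB1)

/-- **Theorem 4.13, conclusion "`μ_A ≼ μ_B`"** (Prop. 4.12): stochastic domination. [cite: BorceaBrandenLiggett2007,
§4.3.1 Thm. 4.13] -/
theorem BorceaBrandenLiggett_thm_4_13_stochDom {μ ν : Finset σ → ℝ}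
    (hμ : IsDeterminantal μ (A.map (algebraMap ℝ ℂ))) (hν : IsDeterminantal ν (B.map (algebraMap ℝ ℂ)))
    (hA : A.PosSemidef) (hAB : (B - A).PosSemidef) (hB1 : (1 - B).PosDef) : StochDom μ ν :=
  (BorceaBrandenLiggett_thm_4_13 hμ hν hA hAB hB1).srLe.stochDom

end Thm413

/-! ## §8 Theorem 4.13 for all positive contractions `A ≤ B ≤ I` ("by continuity") -/

section Contractions

/-- **The determinantal weight of a real kernel `K`** by inclusion–exclusion:
`μ_K(V) = Σ_{S ⊇ V} (-1)^{|S ∖ V|} det K[S]` (the unique weight with `Σ_{T ⊇ S} μ(T) = det K[S]`; generating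
polynomial `det(I - K + KZ)`). [cite: BorceaBrandenLiggett2007, §3.3 (2) ("`μ({S : F ⊆ S}) = det[A(i,j)]_{i,j∈F}`")
and proof of Prop. 3.5 ("`g_μ(z) = det(I - A + AZ)`")] -/
def detWeight (K : Matrix σ σ ℝ) : Finset σ → ℝ := fun V =>
  ∑ S ∈ univ.filter (fun S => V ⊆ S), (-1) ^ (S \ V).card * minorWeight K S

/-- Unfolding `detWeight`. [cite: BorceaBrandenLiggett2007, §3.3 (2)] -/
theorem detWeight_apply (K : Matrix σ σ ℝ) (V : Finset σ) :
    detWeight K V = ∑ S ∈ univ.filter (fun S => V ⊆ S), (-1) ^ (S \ V).card * minorWeight K S := rfl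

omit [Fintype σ] in
/-- `Π_{i∈S} (z_i - 1) = Σ_{V ⊆ S} (-1)^{|S ∖ V|} z^V`. [folklore] -/
private theorem dsd_prod_sub_one (z : σ → ℂ) (S : Finset σ) :
    ∏ i ∈ S, (z i - 1) = ∑ V ∈ S.powerset, (-1 : ℂ) ^ (S \ V).card * ∏ i ∈ V, z i := by
  simp_rw [sub_eq_add_neg]
  rw [Finset.prod_add]
  refine Finset.sum_congr rfl fun V _ => ?_
  rw [Finset.prod_const, mul_comm]

omit [Fintype σ] [DecidableEq σ] in
/-- `Π_{i∈V} (1 + y_i) = Σ_{S ⊆ V} y^S`. [folklore] -/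
private theorem dsd_prod_one_add (y : σ → ℂ) (V : Finset σ) :
    ∏ i ∈ V, (1 + y i) = ∑ S ∈ V.powerset, ∏ i ∈ S, y i :=
  Finset.prod_one_add V

/-- **Generating polynomial of `detWeight K`**: `Σ_V μ_K(V) z^V = det(I - K + diag(z) K)`.
[cite: BorceaBrandenLiggett2007, §3.3 proof of Prop. 3.5] -/
theorem sum_detWeight_mul_prod (K : Matrix σ σ ℝ) (z : σ → ℂ) :
    ∑ V : Finset σ, (detWeight K V : ℂ) * ∏ i ∈ V, z i =
      (1 - K.map (algebraMap ℝ ℂ) + diagonal z * K.map (algebraMap ℝ ℂ)).det := by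
  have hmat : (1 - K.map (algebraMap ℝ ℂ) + diagonal z * K.map (algebraMap ℝ ℂ)) =
      1 + diagonal (fun i => z i - 1) * K.map (algebraMap ℝ ℂ) := by
    have : diagonal (fun i => z i - 1) = diagonal z - 1 := by
      rw [← diagonal_one, ← diagonal_sub]
    rw [this, sub_mul, one_mul]
    abel
  rw [hmat, ← sum_minorWeight_mul_prod]
  simp_rw [dsd_prod_sub_one, Finset.mul_sum]
  -- swap: `Σ_S Σ_{V ⊆ S} = Σ_V Σ_{S ⊇ V}`
  rw [Finset.sum_comm' (t' := univ) (s' := fun V => univ.filter fun S => V ⊆ S)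
    (fun S V => by simp [Finset.mem_powerset])]
  refine Finset.sum_congr rfl fun V _ => ?_
  rw [detWeight_apply]
  push_cast
  rw [Finset.sum_mul]
  refine Finset.sum_congr rfl fun S _ => ?_
  ring

/-- **`detWeight K` is determinantal with kernel `K`**: `Σ_{T ⊇ S} μ_K(T) = det K[S]`.
[cite: BorceaBrandenLiggett2007, §3.3 (2)] -/
theorem isDeterminantal_detWeight (K : Matrix σ σ ℝ) : IsDeterminantal (detWeight K) (K.map (algebraMap ℝ ℂ)) := by
  -- compare the coefficients of `y^S` in `Σ_V μ(V) Π_{i∈V}(1 + y_i) = det(I + diag(y) K) = Σ_S det K[S] y^S`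
  have key : (fun S => ∑ T ∈ univ.filter (fun T => S ⊆ T), detWeight K T) = minorWeight K := by
    refine dsd_eq_of_forall_sum_eq fun y => ?_
    have h1 := sum_detWeight_mul_prod K (fun i => 1 + y i)
    have hmat : (1 - K.map (algebraMap ℝ ℂ) + diagonal (fun i => 1 + y i) * K.map (algebraMap ℝ ℂ)) =
        1 + diagonal y * K.map (algebraMap ℝ ℂ) := by
      have : diagonal (fun i => 1 + y i) = 1 + diagonal y := by rw [← diagonal_one, ← diagonal_add]
      rw [this, add_mul, one_mul]
      abel
    rw [hmat, ← sum_minorWeight_mul_prod] at h1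
    rw [← h1]
    simp_rw [dsd_prod_one_add, Finset.mul_sum]
    rw [Finset.sum_comm' (t' := univ) (s' := fun S => univ.filter fun V => S ⊆ V)
      (fun V S => by simp [Finset.mem_powerset])]
    refine Finset.sum_congr rfl fun S _ => ?_
    push_cast
    rw [Finset.sum_mul]
  intro S
  have hS : ∑ T ∈ univ.filter (fun T => S ⊆ T), detWeight K T = minorWeight K S := congrFun key S
  rw [hS, minorWeight_apply]
  have := RingHom.map_det (algebraMap ℝ ℂ) (K.submatrix (Subtype.val : S → σ) (Subtype.val : S → σ))
  rw [RingHom.mapMatrix_apply] at this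
  exact this

/-- **Uniqueness**: a determinantal weight with real kernel `K` is `detWeight K` (both have generating polynomial
`det(I - K + KZ)`). [cite: BorceaBrandenLiggett2007, §3.3 proof of Prop. 3.5] -/
theorem IsDeterminantal.eq_detWeight {μ : Finset σ → ℝ} {K : Matrix σ σ ℝ}
    (hμ : IsDeterminantal μ (K.map (algebraMap ℝ ℂ))) : μ = detWeight K :=
  dsd_eq_of_forall_sum_eq fun z => by rw [hμ.sum_mul_prod, sum_detWeight_mul_prod]

omit [Fintype σ] in
/-- Principal minors scale: `det (tK)[S] = t^{|S|} det K[S]`. [folklore] -/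
private theorem dsd_minorWeight_smul (t : ℝ) (K : Matrix σ σ ℝ) (S : Finset σ) :
    minorWeight (t • K) S = t ^ S.card * minorWeight K S := by
  rw [minorWeight_apply, minorWeight_apply,
    show (t • K).submatrix (Subtype.val : S → σ) (Subtype.val : S → σ) =
      t • K.submatrix (Subtype.val : S → σ) (Subtype.val : S → σ) from rfl, det_smul, Fintype.card_coe]

/-- `t ↦ μ_{tK}(V)` is continuous (a polynomial in `t`). [cite: BorceaBrandenLiggett2007, §4.3.1 proof of
Prop. 4.15 ("By continuity")] -/
theorem continuous_detWeight_smul (K : Matrix σ σ ℝ) (V : Finset σ) :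
    Continuous fun t : ℝ => detWeight (t • K) V := by
  have h : (fun t : ℝ => detWeight (t • K) V) = fun t =>
      ∑ S ∈ univ.filter (fun S => V ⊆ S), ((-1) ^ (S \ V).card * minorWeight K S) * t ^ S.card := by
    funext t
    rw [detWeight_apply]
    refine Finset.sum_congr rfl fun S _ => ?_
    rw [dsd_minorWeight_smul]
    ring
  rw [h]
  exact continuous_finsetSum _ fun S _ => continuous_const.mul (continuous_pow _)

variable {A B : Matrix σ σ ℝ}

/-- **Borcea–Brändén–Liggett, Theorem 4.13** (all positive contractions): for real symmetric `0 ≤ A ≤ B ≤ I`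
the determinantal measures satisfy `μ_A ⊴ μ_B` — the closed order of Def. 4.1, obtained from the case `B < I`
along `(tA, tB)`, `t ↑ 1` ("By continuity and Lemma 4.14"). [cite: BorceaBrandenLiggett2007, §4.3.1 Thm. 4.13
with Prop. 4.15 and Lemma 4.14] -/
theorem BorceaBrandenLiggett_thm_4_13_srLe {μ ν : Finset σ → ℝ} (hμ : IsDeterminantal μ (A.map (algebraMap ℝ ℂ)))
    (hν : IsDeterminantal ν (B.map (algebraMap ℝ ℂ))) (hA : A.PosSemidef) (hAB : (B - A).PosSemidef)
    (hB1 : (1 - B).PosSemidef) : SRLe μ ν := by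
  set t : ℕ → ℝ := fun k => (k : ℝ) / (k + 1) with ht
  have ht0 : ∀ k, 0 ≤ t k := fun k => div_nonneg (Nat.cast_nonneg k) (by positivity)
  have ht1 : ∀ k, t k < 1 := fun k => (div_lt_one (by positivity)).2 (lt_add_one _)
  have htend : Tendsto t atTop (𝓝 1) := tendsto_natCast_div_add_atTop (1 : ℝ)
  refine ⟨fun k => detWeight (t k • A), fun k => detWeight (t k • B), ?_, ?_, fun k => ?_⟩
  · rw [hμ.eq_detWeight, show detWeight A = detWeight ((1 : ℝ) • A) by rw [one_smul]]
    exact tendsto_pi_nhds.2 fun V => ((continuous_detWeight_smul A V).tendsto 1).comp htend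
  · rw [hν.eq_detWeight, show detWeight B = detWeight ((1 : ℝ) • B) by rw [one_smul]]
    exact tendsto_pi_nhds.2 fun V => ((continuous_detWeight_smul B V).tendsto 1).comp htend
  · have hAk : (t k • A).PosSemidef := hA.smul (ht0 k)
    have hABk : (t k • B - t k • A).PosSemidef := by rw [← smul_sub]; exact hAB.smul (ht0 k)
    have hB1k : (1 - t k • B).PosDef := by
      have h : (1 - t k • B : Matrix σ σ ℝ) = (1 - t k) • (1 : Matrix σ σ ℝ) + t k • (1 - B) := by
        rw [sub_smul, one_smul, smul_sub]; abel
      rw [h]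
      exact (Matrix.PosDef.one.smul (sub_pos.2 (ht1 k))).add_posSemidef (hB1.smul (ht0 k))
    have hμk : IsDeterminantal (detWeight (t k • A)) ((t k • A).map (algebraMap ℝ ℂ)) := isDeterminantal_detWeight _
    have hνk : IsDeterminantal (detWeight (t k • B)) ((t k • B).map (algebraMap ℝ ℂ)) := isDeterminantal_detWeight _
    exact BorceaBrandenLiggett_thm_4_13 hμk hνk hAk hABk hB1k

/-- **Theorem 4.13, conclusion "`μ_A ≼ μ_B`" for all positive contractions** (`⊴` implies `≼` by Prop. 4.12 and
closedness). [cite: BorceaBrandenLiggett2007, §4.3.1 Thm. 4.13] -/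
theorem BorceaBrandenLiggett_thm_4_13_stochDom' {μ ν : Finset σ → ℝ}
    (hμ : IsDeterminantal μ (A.map (algebraMap ℝ ℂ))) (hν : IsDeterminantal ν (B.map (algebraMap ℝ ℂ)))
    (hA : A.PosSemidef) (hAB : (B - A).PosSemidef) (hB1 : (1 - B).PosSemidef) : StochDom μ ν :=
  (BorceaBrandenLiggett_thm_4_13_srLe hμ hν hA hAB hB1).stochDom

end Contractions

end Literature.Probability.NegativeDependence

end
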